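/-
Copyright (c) 2026. All rights reserved.
Released under Apache 2.0 license as described in the file LICENSE.
-/
import Summits.Langlands.Langlands.Theorems.SoloInformedDcrisTrivialTCriterion
import Literature.NumberTheory.Automorphic.AdicCompletionResidueCard
import HarnessLib

/-!
# The crystalline clause for the trivial Galois representation, in the clause's own global context (rung Λ12)

Programme `solo-Langlands-informed`, repair D2-cris of `Summit.Langlands`.  The clause
`D2Cris.CrystallineCompatibleAt ι π ρ v hv` (`Theorems/SoloInformedRepairD2Cris`) lives over a NUMBER FIELD `K`,
a finite place `v ∣ ℓ` and the completion `F := K_v = v.adicCompletion K`; it asks for a `ℚ̄_ℓ`-basis of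
`D_cris(ρ|Γ_{K_v})` indexed by `Fin (n · f(v|ℓ))`, `f(v|ℓ) = v.asIdeal.inertiaDeg ℤ`, in which
`charpoly (φ_D ^ f(v|ℓ)) = geomFrobPolyOfSatake ι α ^ f(v|ℓ)` for the Satake parameter `α` of `π` at `v`.
Rungs Λ10/Λ11 (`Theorems/SoloInformedDcrisTrivialCharpoly`, `…DcrisTrivialTCriterion`) proved the `𝟙_m` instance
of this conclusion for an ABSTRACT `p`-adic field `F` with `q_F = p^f`, from `Irreducible (p : 𝒪[F])` (absolutely
unramified `F`) or from Colmez's criterion (TC).  This file closes the gap between the abstract local statement and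
the clause as typed:

* §1 the three number-field facts the instantiation `F := K_v` needs, proved from Mathlib:
  `q_v = ℓ ^ f(v|ℓ)` for the tree's `residueFieldCard (v.adicCompletion K)`
  (`residueFieldCard_adicCompletion_eq_pow_inertiaDeg`); `|ℓ|_v = exp (-e(v|ℓ))` for `Valued.v` on `K_v`
  (`valued_natCast_adicCompletion_eq_exp_neg_ramificationIdx`); and **`ℓ` is a uniformiser of the valuation ring
  `𝒪[K_v]` of the valuative relation of `K_v` when `e(v|ℓ) = 1`**
  (`irreducible_natCast_valuationInteger_adicCompletion`, through the unit criterion `IsUnit x ↔ Valued.v x = 1`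
  obtained from the equivalence of the two valuations of `K_v`);
* §2 ★★ `exists_basis_charpoly_phiDcris_toLocal_one` : **for every number field `K`, every prime `ℓ`, every place
  `v ∣ ℓ` of `K` with `e(v|ℓ) = 1` and every `ι : ℚ̄_ℓ ≃ ℂ`, the conclusion of `CrystallineCompatibleAt` holds for the
  trivial global representation `𝟙_n : Γ_K → GL_n(ℚ̄_ℓ)` with the parameter `{1, …, 1}`** (instance facts of `K_v` as
  binders; the primed version installs them from `hv` by the clause's own terms, binder-free), so that
  ★ `crystallineCompatibleAt_one_of_ramificationIdx_eq_one` : `CrystallineCompatibleAt ι π 𝟙_n v hv` for every `π`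
  whose Satake parameters at `v` are `{1, …, 1}` is a short corollary; in particular at every `v ∣ ℓ` when `ℓ` is
  unramified in `K` (`forall_crystallineCompatibleAt_one_of_forall_ramificationIdx_eq_one`);
* §3 the same two statements at EVERY place `v ∣ ℓ` (any ramification), conditional on (TC) for `K_v` alone
  (`exists_basis_charpoly_phiDcris_toLocal_one_of_tCriterion`, `crystallineCompatibleAt_one_of_tCriterion`).

No period-ring mathematics is added here: the content is Λ9–Λ11; this file is the plumbing that makes their
conclusion an instance of the clause's literal text (`(𝟙_n).toLocal v = 𝟙_n`, `toLocal_one`).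

References: Neukirch, *Algebraic Number Theory* (1999), Ch. I §8 (`p𝓞_K = ∏ 𝔭^{e_𝔭}`, `𝔑𝔭 = p^{f_𝔭}`), Ch. II §8;
Serre, *Local Fields* (1979), Ch. I §§5–7; Fontaine, Astérisque 223 (1994), Exp. VIII §2.3.7; Colmez, Ann. of
Math. 148 (1998), §III.2–III.3; Buzzard–Gee, LMS LNS 414 (2014), Conj. 3.2.2.
-/

noncomputable section

open scoped MatrixGroups TensorProduct ValuativeRel Polynomial NumberField Classical
open Field IsLocalRing ValuativeRel IsDedekindDomain
open Literature.NumberTheory.GaloisRepresentations Literature.NumberTheory.PAdicHodge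
open Literature.NumberTheory.GaloisRepresentations.IsNonarchimedeanLocalField
open Literature.NumberTheory.Automorphic

namespace Summit.Langlands.Langlands.Theorems

namespace D2Cris

/-! ### §1 Three facts about the completion `K_v` at a place `v ∣ ℓ` -/

section PlaceFacts

variable {K : Type} [Field K] [NumberField K] (v : HeightOneSpectrum (𝓞 K)) {ℓ : ℕ} [Fact ℓ.Prime]

/-- **`q_v = ℓ ^ f(v|ℓ)`** for the residue cardinality of the local field `K_v` in the currency of the clause
(`residueFieldCard (v.adicCompletion K)`; tree `residueFieldCard_adicCompletion_eq`, Mathlib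
`Ideal.absNorm_eq_pow_inertiaDeg'`). [cite: NeukirchANT1999, Ch. I §8 Prop. (8.3)] -/
theorem residueFieldCard_adicCompletion_eq_pow_inertiaDeg (hv : ((ℓ : ℕ) : 𝓞 K) ∈ v.asIdeal) :
    residueFieldCard (v.adicCompletion K) = ℓ ^ v.asIdeal.inertiaDeg ℤ := by
  have hℓ : ℓ.Prime := Fact.out
  have hℓZ : (ℓ : ℤ) ≠ 0 := Int.natCast_ne_zero.mpr hℓ.ne_zero
  haveI : v.asIdeal.IsMaximal := v.isMaximal
  have hmax : (Ideal.span {(ℓ : ℤ)}).IsMaximal :=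
    ((Ideal.span_singleton_prime hℓZ).mpr (Nat.prime_iff_prime_int.mp hℓ)).isMaximal (by simpa using hℓZ)
  haveI := hmax
  haveI : v.asIdeal.LiesOver (Ideal.span {(ℓ : ℤ)}) := by
    refine ⟨hmax.eq_of_le (Ideal.comap_ne_top _ v.isMaximal.ne_top) ?_⟩
    rw [Ideal.span_le, Set.singleton_subset_iff]
    change algebraMap ℤ (𝓞 K) (ℓ : ℤ) ∈ v.asIdeal
    simpa using hv
  rw [residueFieldCard_adicCompletion_eq K v, HeightOneSpectrum.residueCard,
    Ideal.absNorm_eq_pow_inertiaDeg' v.asIdeal hℓ, Ideal.inertiaDeg'_eq_inertiaDeg (Ideal.span {(ℓ : ℤ)}) v.asIdeal]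

/-- **`|ℓ|_v = exp (-e(v|ℓ))`**: the valuation `Valued.v` of `K_v` at the rational prime `ℓ` below `v` is
`exp (-e)` with `e = e(v|ℓ) = v.asIdeal.ramificationIdx ℤ` the multiplicity of `v` in `ℓ𝓞_K`
(Mathlib `Ideal.IsDedekindDomain.ramificationIdx_eq_multiplicity`, `intValuation_eq_exp_neg_multiplicity`).
[cite: NeukirchANT1999, Ch. I §8 and Ch. II (8.2)] -/
theorem valued_natCast_adicCompletion_eq_exp_neg_ramificationIdx (hv : ((ℓ : ℕ) : 𝓞 K) ∈ v.asIdeal) :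
    Valued.v ((ℓ : ℕ) : v.adicCompletion K) = WithZero.exp (-(v.asIdeal.ramificationIdx ℤ : ℤ)) := by
  have hℓ : ℓ.Prime := Fact.out
  have hunder : v.asIdeal.under ℤ = Ideal.span {(ℓ : ℤ)} := by
    have hmax : (Ideal.span {(ℓ : ℤ)}).IsMaximal :=
      PrincipalIdealRing.isMaximal_of_irreducible (Nat.prime_iff_prime_int.mp hℓ).irreducible
    refine (hmax.eq_of_le (Ideal.IsPrime.ne_top inferInstance) ?_).symm
    rw [Ideal.span_le, Set.singleton_subset_iff, SetLike.mem_coe, Ideal.under_def, Ideal.mem_comap, map_natCast]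
    exact hv
  have hmap : (v.asIdeal.under ℤ).map (algebraMap ℤ (𝓞 K)) = Ideal.span {((ℓ : ℕ) : 𝓞 K)} := by
    rw [hunder, Ideal.map_span, Set.image_singleton, map_natCast]
  have hℓ0 : ((ℓ : ℕ) : 𝓞 K) ≠ 0 := by exact_mod_cast hℓ.ne_zero
  have hne : (v.asIdeal.under ℤ).map (algebraMap ℤ (𝓞 K)) ≠ ⊥ := by
    rw [hmap, Ne, Ideal.span_singleton_eq_bot]
    exact hℓ0
  have he : v.asIdeal.ramificationIdx ℤ = multiplicity v.asIdeal (Ideal.span {((ℓ : ℕ) : 𝓞 K)}) := by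
    rw [Ideal.IsDedekindDomain.ramificationIdx_eq_multiplicity (v.asIdeal.under ℤ) v.asIdeal hne, hmap]
  have h1 : ((ℓ : ℕ) : v.adicCompletion K) = (((ℓ : ℕ) : K) : v.adicCompletion K) := by
    rw [← map_natCast (algebraMap K (v.adicCompletion K)) ℓ]
    rfl
  have h2 : ((ℓ : ℕ) : K) = algebraMap (𝓞 K) K ((ℓ : ℕ) : 𝓞 K) := by rw [map_natCast]
  rw [h1, HeightOneSpectrum.valuedAdicCompletion_eq_valuation', h2, HeightOneSpectrum.valuation_of_algebraMap,
    HeightOneSpectrum.intValuation_eq_exp_neg_multiplicity v hℓ0, he]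

/-- **`ℓ` is a uniformiser of `𝒪[K_v]` at a place `v ∣ ℓ` with `e(v|ℓ) = 1`**: `|ℓ|_v = exp (-1)` is not `1`,
and in a factorisation `ℓ = a · b` in `𝒪[K_v]` the integral valuations `exp m`, `exp k` (`m, k ≤ 0`) of the factors
satisfy `m + k = -1`, so one of them is `0`, i.e. one factor is a unit.  Here `𝒪[K_v]` is the valuation ring of
the valuative relation of `K_v` (the ring the `p`-adic Hodge theory files read, `open scoped ValuativeRel`); its
unit criterion `IsUnit x ↔ Valued.v x = 1` is derived in the proof from the equivalence of the two valuations of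
`K_v` (`ValuativeRel.isEquiv`; for the `Valued` valuation ring it is the landed
`Literature.NumberTheory.QuadraticForms.isUnit_integer_iff`).  This is the hypothesis `Irreducible (p : 𝒪[F])` of
rungs Λ6–Λ10 at `F := K_v`. [cite: SerreLocalFields1979, Ch. I §§5–7] [cite: NeukirchANT1999, Ch. II (8.2)] -/
theorem irreducible_natCast_valuationInteger_adicCompletion (hv : ((ℓ : ℕ) : 𝓞 K) ∈ v.asIdeal)
    (he : v.asIdeal.ramificationIdx ℤ = 1) : Irreducible ((ℓ : ℕ) : 𝒪[v.adicCompletion K]) := by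
  -- the two valuations of `K_v` (`ValuativeRel.valuation`, `Valued.v`) are equivalent
  have hequiv := ValuativeRel.isEquiv (valuation (v.adicCompletion K)) (Valued.v : Valuation (v.adicCompletion K) _)
  have hunit : ∀ x : 𝒪[v.adicCompletion K], IsUnit x ↔ Valued.v (x : v.adicCompletion K) = 1 := fun x => by
    rw [(Valuation.integer.integers (valuation (v.adicCompletion K))).isUnit_iff_valuation_eq_one]
    exact hequiv.eq_one_iff_eq_one
  have hle : ∀ x : 𝒪[v.adicCompletion K], Valued.v (x : v.adicCompletion K) ≤ 1 := fun x =>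
    hequiv.le_one_iff_le_one.mp ((Valuation.mem_integer_iff _ _).mp x.2)
  have hVℓ : Valued.v (((ℓ : ℕ) : 𝒪[v.adicCompletion K]) : v.adicCompletion K) = WithZero.exp (-1 : ℤ) := by
    rw [SubringClass.coe_natCast, valued_natCast_adicCompletion_eq_exp_neg_ramificationIdx v hv, he, Nat.cast_one]
  refine irreducible_iff.mpr ⟨?_, fun a b hab => ?_⟩
  · rw [hunit, hVℓ]
    exact ne_of_lt (by rw [← WithZero.exp_zero, WithZero.exp_lt_exp]; norm_num)
  · rw [hunit, hunit]
    by_contra h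
    obtain ⟨ha, hb⟩ := not_or.mp h
    have ha1 : Valued.v (a : v.adicCompletion K) < 1 := lt_of_le_of_ne (hle a) ha
    have hb1 : Valued.v (b : v.adicCompletion K) < 1 := lt_of_le_of_ne (hle b) hb
    have hab' : WithZero.exp (-1 : ℤ) =
        Valued.v (a : v.adicCompletion K) * Valued.v (b : v.adicCompletion K) := by
      rw [← hVℓ, hab, Subring.coe_mul, map_mul]
    have ha0 : Valued.v (a : v.adicCompletion K) ≠ 0 := by
      intro h0; rw [h0, zero_mul] at hab'; exact WithZero.exp_ne_zero hab'
    have hb0 : Valued.v (b : v.adicCompletion K) ≠ 0 := by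
      intro h0; rw [h0, mul_zero] at hab'; exact WithZero.exp_ne_zero hab'
    obtain ⟨m, hm⟩ : ∃ m : ℤ, Valued.v (a : v.adicCompletion K) = WithZero.exp m :=
      ⟨_, (WithZero.exp_log ha0).symm⟩
    obtain ⟨k, hk⟩ : ∃ k : ℤ, Valued.v (b : v.adicCompletion K) = WithZero.exp k :=
      ⟨_, (WithZero.exp_log hb0).symm⟩
    rw [hm, hk, ← WithZero.exp_add, WithZero.exp_inj] at hab'
    rw [hm, ← WithZero.exp_zero, WithZero.exp_lt_exp] at ha1
    rw [hk, ← WithZero.exp_zero, WithZero.exp_lt_exp] at hb1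
    omega

end PlaceFacts

/-! ### §2 The clause's conclusion for the trivial global representation at a place with `e(v|ℓ) = 1` -/

section Packaging

variable {n : ℕ} {K : Type} [Field K] [NumberField K] {hcpt : isCompact_glFiniteIntegralLevel n K}
  {ℓ : ℕ} [Fact ℓ.Prime]

/-- The local representation at `v` of the trivial global framed representation `𝟙_n : Γ_K → GL_n(E)` is the
trivial representation of `Γ_{K_v}`. [folklore] -/
theorem toLocal_one {E : Type*} [CommRing E] [TopologicalSpace E] [IsTopologicalRing E]
    (v : HeightOneSpectrum (𝓞 K)) : (1 : FramedGaloisRep K E n).toLocal v = 1 :=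
  ContinuousMonoidHom.ext fun _ => rfl

/-- ★★ **The conclusion of `CrystallineCompatibleAt` for the trivial global representation at an absolutely
unramified place.**  For every number field `K`, prime `ℓ`, finite place `v ∣ ℓ` of `K` with `e(v|ℓ) = 1` and
`ι : ℚ̄_ℓ ≃ ℂ`: `D_cris(𝟙_n|Γ_{K_v})` over the constructed `B_max(K_v)` has a `ℚ̄_ℓ`-basis indexed by
`Fin (n · f(v|ℓ))` in which `charpoly (φ_D ^ f(v|ℓ)) = geomFrobPolyOfSatake ι {1, …, 1} ^ f(v|ℓ)`
(`= (X - 1)^{n·f(v|ℓ)}`) — rung Λ10 `SpecC.exists_basis_charpoly_eq_geomFrobPolyOfSatake_pow_of_unramified'` at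
`F := K_v`, fed by §1.  The three instance facts of `K_v` (`char 0`, `ℓ ∉ 𝒪_{ℂ_{K_v}}^×`, `ℓ`-adic completeness of
`𝒪_{ℂ_{K_v}}`) are binders here; the primed version below installs them from `hv` exactly as the clause does (any
two instances agree, being proofs of propositions).  Input-free.
[cite: BuzzardGeeLMS2014, Conj. 3.2.2] [cite: FontaineAsterisque223VIII, §2.3.7] -/
theorem exists_basis_charpoly_phiDcris_toLocal_one (ι : PadicAlgCl ℓ ≃+* ℂ) (v : HeightOneSpectrum (𝓞 K))
    (hv : ((ℓ : ℕ) : 𝓞 K) ∈ v.asIdeal) (he : v.asIdeal.ramificationIdx ℤ = 1) [CharZero (v.adicCompletion K)]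
    [Fact (¬ IsUnit ((ℓ : ℕ) : integerC (v.adicCompletion K)))]
    [IsAdicComplete (Ideal.span {((ℓ : ℕ) : integerC (v.adicCompletion K))}) (integerC (v.adicCompletion K))] :
    ∃ b : Module.Basis (Fin (n * v.asIdeal.inertiaDeg ℤ)) (PadicAlgCl ℓ)
        (Dcris (p := ℓ) ((1 : FramedGaloisRep K (PadicAlgCl ℓ) n).toLocal v)),
      (LinearMap.toMatrix b b
          (phiDcris (p := ℓ) ((1 : FramedGaloisRep K (PadicAlgCl ℓ) n).toLocal v) ^ v.asIdeal.inertiaDeg ℤ)).charpoly =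
        geomFrobPolyOfSatake ι (Multiset.replicate n 1) ^ v.asIdeal.inertiaDeg ℤ := by
  rw [toLocal_one]
  exact SpecC.exists_basis_charpoly_eq_geomFrobPolyOfSatake_pow_of_unramified'
    (LocalField.valuation_adicCompletion_natCast_lt_one v ℓ hv)
    (irreducible_natCast_valuationInteger_adicCompletion v hv he)
    (residueFieldCard_adicCompletion_eq_pow_inertiaDeg v hv) ι

/-- ★★ The same statement **with no instance binders at all**: the instance facts of `K_v` are installed from `hv`
by the very terms the clause `CrystallineCompatibleAt` uses (`LocalField.charZero_adicCompletion`,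
`not_isUnit_natCast_integerC`, `isAdicComplete_integerC_natCast`).  For every number field `K`, prime `ℓ`, place
`v ∣ ℓ` with `e(v|ℓ) = 1` and `ι`, unconditionally. [cite: BuzzardGeeLMS2014, Conj. 3.2.2]
[cite: FontaineAsterisque223VIII, §2.3.7] -/
theorem exists_basis_charpoly_phiDcris_toLocal_one' (ι : PadicAlgCl ℓ ≃+* ℂ) (v : HeightOneSpectrum (𝓞 K))
    (hv : ((ℓ : ℕ) : 𝓞 K) ∈ v.asIdeal) (he : v.asIdeal.ramificationIdx ℤ = 1) :
    haveI := LocalField.charZero_adicCompletion v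
    haveI : Fact (¬ IsUnit ((ℓ : ℕ) : integerC (v.adicCompletion K))) :=
      ⟨not_isUnit_natCast_integerC (LocalField.valuation_adicCompletion_natCast_lt_one v ℓ hv)⟩
    haveI : IsAdicComplete (Ideal.span {((ℓ : ℕ) : integerC (v.adicCompletion K))})
        (integerC (v.adicCompletion K)) :=
      isAdicComplete_integerC_natCast (LocalField.valuation_adicCompletion_natCast_lt_one v ℓ hv)
    ∃ b : Module.Basis (Fin (n * v.asIdeal.inertiaDeg ℤ)) (PadicAlgCl ℓ)
        (Dcris (p := ℓ) ((1 : FramedGaloisRep K (PadicAlgCl ℓ) n).toLocal v)),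
      (LinearMap.toMatrix b b
          (phiDcris (p := ℓ) ((1 : FramedGaloisRep K (PadicAlgCl ℓ) n).toLocal v) ^ v.asIdeal.inertiaDeg ℤ)).charpoly =
        geomFrobPolyOfSatake ι (Multiset.replicate n 1) ^ v.asIdeal.inertiaDeg ℤ := by
  haveI := LocalField.charZero_adicCompletion v
  have hp := LocalField.valuation_adicCompletion_natCast_lt_one v ℓ hv
  haveI : Fact (¬ IsUnit ((ℓ : ℕ) : integerC (v.adicCompletion K))) := ⟨not_isUnit_natCast_integerC hp⟩
  haveI : IsAdicComplete (Ideal.span {((ℓ : ℕ) : integerC (v.adicCompletion K))})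
      (integerC (v.adicCompletion K)) := isAdicComplete_integerC_natCast hp
  exact exists_basis_charpoly_phiDcris_toLocal_one ι v hv he

/-- ★ **`CrystallineCompatibleAt ι π 𝟙_n v hv` at an absolutely unramified place `v ∣ ℓ`, for every `π` whose
Satake parameters at `v` are `{1, …, 1}`** (the parameter the summit's untwisted dictionary attaches to the trivial
representation: all Frobenius eigenvalues `1`): the clause as typed, instance for instance.
[cite: BuzzardGeeLMS2014, Conj. 3.2.2] -/
theorem crystallineCompatibleAt_one_of_ramificationIdx_eq_one (ι : PadicAlgCl ℓ ≃+* ℂ)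
    (π : AutomorphicRepData (AutomorphyDatum.gl n K hcpt)) (v : HeightOneSpectrum (𝓞 K))
    (hv : ((ℓ : ℕ) : 𝓞 K) ∈ v.asIdeal) (he : v.asIdeal.ramificationIdx ℤ = 1)
    (hπ : ∀ α : Multiset ℂ, π.HasSatakeParamAt v α → α = Multiset.replicate n 1) :
    CrystallineCompatibleAt ι π (1 : FramedGaloisRep K (PadicAlgCl ℓ) n) v hv := by
  unfold CrystallineCompatibleAt
  intro α hα
  obtain rfl := hπ α hα
  haveI := LocalField.charZero_adicCompletion v
  have hp := LocalField.valuation_adicCompletion_natCast_lt_one v ℓ hv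
  haveI : Fact (¬ IsUnit ((ℓ : ℕ) : integerC (v.adicCompletion K))) := ⟨not_isUnit_natCast_integerC hp⟩
  haveI : IsAdicComplete (Ideal.span {((ℓ : ℕ) : integerC (v.adicCompletion K))})
      (integerC (v.adicCompletion K)) := isAdicComplete_integerC_natCast hp
  exact exists_basis_charpoly_phiDcris_toLocal_one ι v hv he

/-- **All places above `ℓ` at once, for `ℓ` unramified in `K`** (`e(v|ℓ) = 1` for every `v ∣ ℓ`): the `v ∣ ℓ`
half of `CorrespondsD2Cris` for the pair (`π` with parameters `{1, …, 1}` above `ℓ`, `𝟙_n`).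
[cite: BuzzardGeeLMS2014, Conj. 3.2.2] -/
theorem forall_crystallineCompatibleAt_one_of_forall_ramificationIdx_eq_one (ι : PadicAlgCl ℓ ≃+* ℂ)
    (π : AutomorphicRepData (AutomorphyDatum.gl n K hcpt))
    (hK : ∀ v : HeightOneSpectrum (𝓞 K), ((ℓ : ℕ) : 𝓞 K) ∈ v.asIdeal → v.asIdeal.ramificationIdx ℤ = 1)
    (hπ : ∀ v : HeightOneSpectrum (𝓞 K), ((ℓ : ℕ) : 𝓞 K) ∈ v.asIdeal →
      ∀ α : Multiset ℂ, π.HasSatakeParamAt v α → α = Multiset.replicate n 1) :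
    ∀ (v : HeightOneSpectrum (𝓞 K)) (hv : ((ℓ : ℕ) : 𝓞 K) ∈ v.asIdeal),
      CrystallineCompatibleAt ι π (1 : FramedGaloisRep K (PadicAlgCl ℓ) n) v hv :=
  fun v hv => crystallineCompatibleAt_one_of_ramificationIdx_eq_one ι π v hv (hK v hv) (hπ v hv)

end Packaging

/-! ### §3 Every place `v ∣ ℓ`, conditional on Colmez's criterion (TC) for `K_v` -/

section PackagingTC

variable {n : ℕ} {K : Type} [Field K] [NumberField K] {hcpt : isCompact_glFiniteIntegralLevel n K}
  {ℓ : ℕ} [Fact ℓ.Prime]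

/-- ★★ **The conclusion of `CrystallineCompatibleAt` for the trivial global representation at EVERY place
`v ∣ ℓ`, conditional on (TC) for `K_v` alone** (rung Λ11
`SpecC.exists_basis_charpoly_eq_geomFrobPolyOfSatake_pow_of_tCriterion'` at `F := K_v`; the instance facts of
`K_v` are binders here, discharged from `hv` by the clause — any two agree, being propositions).
[cite: BuzzardGeeLMS2014, Conj. 3.2.2] [cite: Colmez1998Annals, §III.2–III.3] -/
theorem exists_basis_charpoly_phiDcris_toLocal_one_of_tCriterion (ι : PadicAlgCl ℓ ≃+* ℂ)
    (v : HeightOneSpectrum (𝓞 K)) (hv : ((ℓ : ℕ) : 𝓞 K) ∈ v.asIdeal) [CharZero (v.adicCompletion K)]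
    [Fact (¬ IsUnit ((ℓ : ℕ) : integerC (v.adicCompletion K)))]
    [IsAdicComplete (Ideal.span {((ℓ : ℕ) : integerC (v.adicCompletion K))}) (integerC (v.adicCompletion K))]
    (hTC : ∀ x : BmaxPlus (v.adicCompletion K) ℓ,
      (∀ k : ℕ, thetaBmaxPlus (v.adicCompletion K) ℓ ((frobBmaxPlus (v.adicCompletion K) ℓ)^[k] x) = 0) →
        ∃ (k : ℕ) (x' : BmaxPlus (v.adicCompletion K) ℓ),
          ((ℓ : ℕ) : BmaxPlus (v.adicCompletion K) ℓ) ^ k * x = tBmax * x') :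
    ∃ b : Module.Basis (Fin (n * v.asIdeal.inertiaDeg ℤ)) (PadicAlgCl ℓ)
        (Dcris (p := ℓ) ((1 : FramedGaloisRep K (PadicAlgCl ℓ) n).toLocal v)),
      (LinearMap.toMatrix b b
          (phiDcris (p := ℓ) ((1 : FramedGaloisRep K (PadicAlgCl ℓ) n).toLocal v) ^ v.asIdeal.inertiaDeg ℤ)).charpoly =
        geomFrobPolyOfSatake ι (Multiset.replicate n 1) ^ v.asIdeal.inertiaDeg ℤ := by
  rw [toLocal_one]
  exact SpecC.exists_basis_charpoly_eq_geomFrobPolyOfSatake_pow_of_tCriterion'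
    (LocalField.valuation_adicCompletion_natCast_lt_one v ℓ hv) hTC
    (residueFieldCard_adicCompletion_eq_pow_inertiaDeg v hv) ι

/-- ★ **`CrystallineCompatibleAt ι π 𝟙_n v hv` at EVERY place `v ∣ ℓ`, conditional on (TC) for `K_v`**, for
every `π` whose Satake parameters at `v` are `{1, …, 1}`. [cite: BuzzardGeeLMS2014, Conj. 3.2.2]
[cite: Colmez1998Annals, §III.2–III.3] -/
theorem crystallineCompatibleAt_one_of_tCriterion (ι : PadicAlgCl ℓ ≃+* ℂ)
    (π : AutomorphicRepData (AutomorphyDatum.gl n K hcpt)) (v : HeightOneSpectrum (𝓞 K))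
    (hv : ((ℓ : ℕ) : 𝓞 K) ∈ v.asIdeal) [CharZero (v.adicCompletion K)]
    [Fact (¬ IsUnit ((ℓ : ℕ) : integerC (v.adicCompletion K)))]
    [IsAdicComplete (Ideal.span {((ℓ : ℕ) : integerC (v.adicCompletion K))}) (integerC (v.adicCompletion K))]
    (hTC : ∀ x : BmaxPlus (v.adicCompletion K) ℓ,
      (∀ k : ℕ, thetaBmaxPlus (v.adicCompletion K) ℓ ((frobBmaxPlus (v.adicCompletion K) ℓ)^[k] x) = 0) →
        ∃ (k : ℕ) (x' : BmaxPlus (v.adicCompletion K) ℓ),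
          ((ℓ : ℕ) : BmaxPlus (v.adicCompletion K) ℓ) ^ k * x = tBmax * x')
    (hπ : ∀ α : Multiset ℂ, π.HasSatakeParamAt v α → α = Multiset.replicate n 1) :
    CrystallineCompatibleAt ι π (1 : FramedGaloisRep K (PadicAlgCl ℓ) n) v hv := by
  unfold CrystallineCompatibleAt
  intro α hα
  obtain rfl := hπ α hα
  exact exists_basis_charpoly_phiDcris_toLocal_one_of_tCriterion ι v hv hTC

end PackagingTC

end D2Cris

end Summit.Langlands.Langlands.Theorems

end
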